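import Literature.MathematicalPhysics.KineticTheory.LangevinChainKernel
import Literature.MathematicalPhysics.KineticTheory.LangevinChainGibbs
import Literature.MathematicalPhysics.KineticTheory.LangevinChainDynkin
import Literature.MathematicalPhysics.KineticTheory.LangevinChainNESSProofs
import Mathlib.Analysis.SpecialFunctions.ImproperIntegrals
import Mathlib.MeasureTheory.Integral.ExpDecay
import Mathlib.MeasureTheory.Function.L2Space
import HarnessLib

/-!
# Crux `ExtensiveSnapshotIrreversibility` (stmt-AtomisticToContinuum-9121), line `clausius-budget-sound-window`:
stub `stub_correctorIntegrability`

Registered stub of the lead's checked skeleton `Cruxes/ExtensiveSnapshotIrreversibility/Lines/clausius-budget-sound-window.lean`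
(namespace `…Cruxes.ExtensiveSnapshotIrreversibility.ClausiusBudgetSoundWindow`), proved verbatim (name + signature) so that
`ledger propose --supports stmt-AtomisticToContinuum-9121` accepts it. See the skeleton's module docstring for the line and the
`let`-dictionary (`μT, g, Pg, k, w, Pw`).

Content: for the pinned chain at fixed `N ≥ 2` with both baths at `T > 0` (equilibrium kernels
`P_t`, Gibbs state `μ_T`), the McLennan / Green–Kubo corrector `w = ∫₀^∞ P_s g ds` of the contact
source `g = (γ/2T²)(p_0² - p_{N-1}²)` converges absolutely, lies in `L²(μ_T)` together with the
window response `∫₀^τ P_s g ds` and `P_τ w`, and satisfies the window identity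
`w = ∫₀^τ P_s g ds + P_τ w` pointwise — GIVEN the exponential convergence (2.5) of
Cuneo–Eckmann–Hairer–Rey-Bellet 2018 in the `e^{ϑH}`-weighted norm (a hypothesis of the
registered statement; the Gibbs-invariance hypothesis is not used). Route: `μ_T(g) = 0` by the
exchange symmetry `p_0 ↔ p_{N-1}` of the Gibbs state; `|g| ≤ M e^{ϑH}`, `ϑ = 1/(4T)`, so (2.5)
gives `|P_s g(z)| ≤ MC e^{ϑH(z)} e^{-cs}`; domination by `e^{ϑH} ∈ L²(μ_T)`; the identity is
`∫₀^∞ = ∫₀^τ + ∫_τ^∞`, translation, Chapman–Kolmogorov and Fubini with the majorant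
`MC e^{-cu} e^{ϑH(x)}` on `(0,∞) × P_τ(z,dx)` (CEHR (3.4)). All inputs are proved tree theorems.

References: N. Cuneo, J.-P. Eckmann, M. Hairer, L. Rey-Bellet, *Non-equilibrium steady states for
networks of oscillators*, EJP 23 (2018) no. 55, Thm 2.13 (3) / eq. (2.5), §3 eq. (3.4);
J. A. McLennan, Phys. Rev. 115 (1959) (the corrector `∫₀^∞ P_s g ds`).
-/

noncomputable section

namespace Summit.AtomisticToContinuum.FouriersLaw.Theorems.ExtensiveSnapshotIrreversibility.ClausiusBudget

open MeasureTheory ProbabilityTheory Filter Topology Set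
open scoped ENNReal NNReal
open Literature.MathematicalPhysics.KineticTheory.HeatConduction

section Helpers

variable {N : ℕ}

/-- **Exchange symmetry of the Gibbs state.** For every oscillator chain of the pinned family and
all parameters, `∫ a (p_i² - p_j²) dμ_T = 0`: the coordinate permutation `p_i ↔ p_j` of the momenta
preserves Lebesgue measure and the Hamiltonian (`H = ∑ p²/2 + Φ(q)`), hence the Gibbs density, and
reverses the sign of the integrand (no integrability needed: both sides are the same Bochner
integral). [folklore] -/
theorem integral_sq_sub_sq_gibbsMeasure (ω₂ lam β γ a T : ℝ) (i j : Fin N) :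
    ∫ y, a * (y.2 i ^ 2 - y.2 j ^ 2) ∂((pinnedChain ω₂ lam β γ).gibbsMeasure N T) = 0 := by
  set P := pinnedChain ω₂ lam β γ with hP
  rw [P.integral_gibbsMeasure]
  -- the exchange of the momenta `p_i ↔ p_j`
  set e : Fin N ≃ Fin N := Equiv.swap i j with he
  set σp : (Fin N → ℝ) ≃ᵐ (Fin N → ℝ) :=
    (MeasurableEquiv.piCongrLeft (fun _ : Fin N => ℝ) e).symm with hσp
  set σ : PhaseSpace N ≃ᵐ PhaseSpace N :=
    MeasurableEquiv.prodCongr (MeasurableEquiv.refl (Fin N → ℝ)) σp with hσ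
  have hσm : MeasurePreserving σ (volume : Measure (PhaseSpace N)) volume :=
    (MeasurePreserving.id (volume : Measure (Fin N → ℝ))).prod
      ((volume_measurePreserving_piCongrLeft (fun _ : Fin N => ℝ) e).symm _)
  have hσ_apply : ∀ x : PhaseSpace N, σ x = (x.1, fun k => x.2 (e k)) := fun x => rfl
  have hH : ∀ x : PhaseSpace N, P.hamiltonian N (σ x) = P.hamiltonian N x := by
    intro x
    rw [hσ_apply, P.hamiltonian_eq_kinetic_add_potential, P.hamiltonian_eq_kinetic_add_potential]
    simp only
    rw [Equiv.sum_comp e (fun k => x.2 k ^ 2 / 2)]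
  have h := hσm.integral_comp' (f := σ) fun x => a * (x.2 i ^ 2 - x.2 j ^ 2) * P.gibbsDensity N T x
  have hρ : ∀ x, P.gibbsDensity N T (σ x) = P.gibbsDensity N T x := fun x => by
    simp only [OscillatorChain.gibbsDensity, hH]
  have hi : ∀ x : PhaseSpace N, (σ x).2 i = x.2 j := fun x => by
    rw [hσ_apply]; simp [he, Equiv.swap_apply_left]
  have hj : ∀ x : PhaseSpace N, (σ x).2 j = x.2 i := fun x => by
    rw [hσ_apply]; simp [he, Equiv.swap_apply_right]
  simp only [hρ, hi, hj] at h
  have h0 : ∫ x, a * (x.2 i ^ 2 - x.2 j ^ 2) * P.gibbsDensity N T x = 0 := by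
    have h' : ∫ x, a * (x.2 j ^ 2 - x.2 i ^ 2) * P.gibbsDensity N T x =
        -∫ x, a * (x.2 i ^ 2 - x.2 j ^ 2) * P.gibbsDensity N T x := by
      rw [← integral_neg]
      refine integral_congr_ae (Eventually.of_forall fun x => ?_)
      ring
    linarith
  rw [h0, mul_zero]

variable {ω₂ lam β : ℝ}

/-- **Growth of the contact source.** For the pinned chain with `ω₂, lam, β ≥ 0` (so that
`H ≥ ∑ p_k²/2 ≥ 0`) and every `ϑ > 0`:
`|a (p_i² - p_j²)| ≤ 4|a| H ≤ (4|a|/ϑ) e^{ϑH}` (using `x ≤ e^x`). [folklore] -/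
theorem abs_mul_sq_sub_sq_le_exp (hω : 0 ≤ ω₂) (hl : 0 ≤ lam) (hβ : 0 ≤ β) (γ a : ℝ) {ϑ : ℝ}
    (hϑ : 0 < ϑ) (i j : Fin N) (y : PhaseSpace N) :
    |a * (y.2 i ^ 2 - y.2 j ^ 2)| ≤
      4 * |a| / ϑ * Real.exp (ϑ * (pinnedChain ω₂ lam β γ).hamiltonian N y) := by
  set H := (pinnedChain ω₂ lam β γ).hamiltonian N y with hH
  have hH0 : 0 ≤ H := pinnedChain_hamiltonian_nonneg hω hl hβ γ N y
  have hharm := pinnedChain_harmonic_le_hamiltonian (ω₂ := ω₂) hl hβ γ N y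
  have hq : 0 ≤ ∑ k, ω₂ * y.1 k ^ 2 / 2 := Finset.sum_nonneg fun k _ => by positivity
  have hpk : ∀ k, y.2 k ^ 2 ≤ 2 * H := fun k => by
    have h1 := Finset.single_le_sum (f := fun k => y.2 k ^ 2 / 2) (fun k _ => by positivity)
      (Finset.mem_univ k)
    linarith
  have hdiff : |y.2 i ^ 2 - y.2 j ^ 2| ≤ 4 * H := by
    rw [abs_le]
    constructor <;> nlinarith [hpk i, hpk j, sq_nonneg (y.2 i), sq_nonneg (y.2 j)]
  have hexp : ϑ * H ≤ Real.exp (ϑ * H) := by linarith [Real.add_one_le_exp (ϑ * H)]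
  have hHexp : H ≤ Real.exp (ϑ * H) / ϑ := by
    rw [le_div_iff₀ hϑ]; linarith
  calc |a * (y.2 i ^ 2 - y.2 j ^ 2)| = |a| * |y.2 i ^ 2 - y.2 j ^ 2| := abs_mul _ _
    _ ≤ |a| * (4 * (Real.exp (ϑ * H) / ϑ)) := by
        refine mul_le_mul_of_nonneg_left (hdiff.trans ?_) (abs_nonneg _)
        linarith
    _ = 4 * |a| / ϑ * Real.exp (ϑ * H) := by ring

variable {γ T : ℝ} (hω : 0 < ω₂) (hl : 0 < lam) (hβ : 0 < β) (hγ : 0 < γ) (hT : 0 < T) (hN : 0 < N)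
include hω hl hβ hγ hT hN

/-- **Exponential moments of the equilibrium kernels.** For the pinned chain (`ω₂, lam, β, γ > 0`,
`N ≥ 1`, both baths at `T > 0`) and `0 < ϑ < 1/T`, the weight `e^{ϑH}` is integrable for every
transition probability `P_t(z, ·)` — the real-valued form of CEHR (3.4),
`E_z e^{ϑH(z_t)} ≤ e^{2ϑγTt} e^{ϑH(z)} < ∞` (`lintegral_exp_mul_hamiltonian_pinnedChainSemigroup_le`).
[cite: CuneoEckmannHairerReyBellet2018, §3 eq. (3.4)] -/
theorem integrable_exp_mul_hamiltonian_transitionKernel {ϑ : ℝ} (hϑ : 0 < ϑ) (hϑT : ϑ < 1 / T)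
    (t : ℝ≥0) (z : PhaseSpace N) :
    Integrable (fun y => Real.exp (ϑ * (pinnedChain ω₂ lam β γ).hamiltonian N y))
      ((pinnedChain ω₂ lam β γ).transitionKernel N T T t z) := by
  have hϑ' : ϑ < 1 / max T T := by rwa [max_self]
  have h34 := lintegral_exp_mul_hamiltonian_pinnedChainSemigroup_le hω hl.le hβ.le hγ.le hN hT.le
    hT.le hT hT hϑ hϑ' t z
  have hVc : Continuous fun y => Real.exp (ϑ * (pinnedChain ω₂ lam β γ).hamiltonian N y) :=
    Real.continuous_exp.comp (continuous_const.mul (pinnedChain_continuous_hamiltonian ω₂ lam β γ N))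
  refine ⟨hVc.aestronglyMeasurable, ?_⟩
  rw [hasFiniteIntegral_iff_ofReal (Eventually.of_forall fun y => (Real.exp_pos _).le)]
  exact h34.trans_lt ENNReal.ofReal_lt_top

/-- **The McLennan corrector from exponential decay (kernel/Bochner plumbing).** For the pinned
chain at equilibrium temperature `T` and a continuous `g` with `|g| ≤ M e^{ϑH}` (`0 < ϑ`,
`2ϑ < 1/T`) whose evolved values decay as `|P_t g(z)| ≤ M C e^{ϑH(z)} e^{-ct}` (`c > 0`): with
`Pg s z = P_{s⁺} g(z)`, `k τ = ∫₀^τ Pg s ds`, `w = ∫_{(0,∞)} Pg s ds`, `Pw τ = P_{τ⁺} w` (given by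
their defining equations), the time integral converges absolutely, `w, k τ, Pw τ ∈ L²(μ_T)` and
`w = k τ + Pw τ` pointwise for `τ ≥ 0`. Ingredients: joint measurability of `(s, z) ↦ P_s g(z)`,
the sup bounds `|w|, |k τ| ≤ (MC/c) e^{ϑH}` with `e^{ϑH} ∈ L²(μ_T)`, the splitting
`∫_{(0,∞)} = ∫₀^τ + ∫_{(τ,∞)}`, translation, Chapman–Kolmogorov and Fubini with the majorant
`MC e^{-cu} e^{ϑH(x)}` on `(0,∞) × P_τ(z,dx)`; finally `Pw τ = w - k τ`. [folklore] -/
theorem corrector_window_of_decay {ϑ M C c : ℝ} (hϑ : 0 < ϑ) (h2ϑ : 2 * ϑ < 1 / T) (hM : 0 ≤ M)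
    (hC : 0 ≤ C) (hc : 0 < c) {g : PhaseSpace N → ℝ} (hg : Continuous g)
    (hgM : ∀ y, |g y| ≤ M * Real.exp (ϑ * (pinnedChain ω₂ lam β γ).hamiltonian N y))
    (hdecay : ∀ (z : PhaseSpace N) (t : ℝ≥0),
      |∫ y, g y ∂((pinnedChain ω₂ lam β γ).transitionKernel N T T t z)| ≤
        M * C * Real.exp (ϑ * (pinnedChain ω₂ lam β γ).hamiltonian N z) * Real.exp (-c * t))
    (Pg : ℝ → PhaseSpace N → ℝ)
    (hPg : Pg = fun s z => ∫ y, g y ∂((pinnedChain ω₂ lam β γ).transitionKernel N T T s.toNNReal z))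
    (k : ℝ → PhaseSpace N → ℝ) (hk : k = fun τ z => ∫ s in (0 : ℝ)..τ, Pg s z)
    (w : PhaseSpace N → ℝ) (hw : w = fun z => ∫ s in Set.Ioi (0 : ℝ), Pg s z)
    (Pw : ℝ → PhaseSpace N → ℝ)
    (hPw : Pw = fun τ z => ∫ x, w x ∂((pinnedChain ω₂ lam β γ).transitionKernel N T T τ.toNNReal z)) :
    (∀ z : PhaseSpace N, IntegrableOn (fun s => Pg s z) (Set.Ioi (0 : ℝ))) ∧
    MemLp w 2 ((pinnedChain ω₂ lam β γ).gibbsMeasure N T) ∧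
    ∀ τ : ℝ, 0 ≤ τ → MemLp (k τ) 2 ((pinnedChain ω₂ lam β γ).gibbsMeasure N T) ∧
      MemLp (Pw τ) 2 ((pinnedChain ω₂ lam β γ).gibbsMeasure N T) ∧
      ∀ z : PhaseSpace N, w z = k τ z + Pw τ z := by
  set P := pinnedChain ω₂ lam β γ with hP
  set κ := P.transitionKernel N T T with hκ
  set H := P.hamiltonian N with hH
  set μT := P.gibbsMeasure N T with hμT
  haveI hMk : ∀ t, IsMarkovKernel (κ t) := fun t =>
    pinnedChain_isMarkovKernel_transitionKernel hω hl.le hβ.le hγ.le N T T t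
  haveI : IsProbabilityMeasure μT :=
    pinnedChain_isProbabilityMeasure_gibbsMeasure hω hl.le hβ.le γ N hT
  have hϑT : ϑ < 1 / T := by linarith
  have hPg_apply : ∀ s z, Pg s z = ∫ y, g y ∂(κ s.toNNReal z) := fun s z => by rw [hPg]
  have hw_apply : ∀ z, w z = ∫ s in Ioi (0 : ℝ), Pg s z := fun z => by rw [hw]
  have hk_apply : ∀ τ z, k τ z = ∫ s in (0 : ℝ)..τ, Pg s z := fun τ z => by rw [hk]
  have hPw_apply : ∀ τ z, Pw τ z = ∫ x, w x ∂(κ τ.toNNReal z) := fun τ z => by rw [hPw]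
  -- the weight `e^{ϑH}`: continuity, kernel moments, `L²(μ_T)`
  have hHc : Continuous H := pinnedChain_continuous_hamiltonian ω₂ lam β γ N
  have hVc : Continuous fun y => Real.exp (ϑ * H y) :=
    Real.continuous_exp.comp (continuous_const.mul hHc)
  have hVint : ∀ (t : ℝ≥0) (z : PhaseSpace N), Integrable (fun y => Real.exp (ϑ * H y)) (κ t z) :=
    fun t z => integrable_exp_mul_hamiltonian_transitionKernel hω hl hβ hγ hT hN hϑ hϑT t z
  have hexp2 : MemLp (fun z => Real.exp (ϑ * H z)) 2 μT := by
    rw [memLp_two_iff_integrable_sq hVc.aestronglyMeasurable]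
    have h := pinnedChain_integrable_exp_mul_hamiltonian_gibbsMeasure hω hl.le hβ.le γ N hT h2ϑ
    refine h.congr (Eventually.of_forall fun z => ?_)
    change Real.exp (2 * ϑ * H z) = Real.exp (ϑ * H z) ^ 2
    rw [sq, ← Real.exp_add]
    congr 1
    ring
  have hL2 : ∀ {f : PhaseSpace N → ℝ} (K : ℝ), StronglyMeasurable f →
      (∀ z, |f z| ≤ K * Real.exp (ϑ * H z)) → MemLp f 2 μT := by
    intro f K hf hb
    refine hexp2.of_le_mul (c := K) hf.aestronglyMeasurable (Eventually.of_forall fun z => ?_)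
    rw [Real.norm_eq_abs, Real.norm_eq_abs, abs_of_pos (Real.exp_pos _)]
    exact hb z
  -- `g` is integrable for every kernel
  have hgint : ∀ (t : ℝ≥0) (z : PhaseSpace N), Integrable g (κ t z) := fun t z =>
    ((hVint t z).const_mul M).mono' hg.aestronglyMeasurable
      (Eventually.of_forall fun y => by rw [Real.norm_eq_abs]; exact hgM y)
  -- joint measurability of `(s, z) ↦ Pg s z`
  set S := pinnedChainSemigroup hω hl.le hβ.le hγ.le hN hT.le hT.le with hS
  have hSM : StronglyMeasurable (Function.uncurry Pg) := by
    have h := (S.stronglyMeasurable_uncurry_act hg.stronglyMeasurable).comp_measurable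
      measurable_swap
    rw [hPg]
    exact h
  have hSMz : ∀ z : PhaseSpace N, StronglyMeasurable fun s => Pg s z := fun z =>
    hSM.comp_measurable measurable_prodMk_right
  -- the decay bound for all real times (`P_{s⁺}` and `e^{-cs⁺} ≤ e^{-cs}`)
  have hPgb : ∀ (s : ℝ) (z : PhaseSpace N),
      |Pg s z| ≤ M * C * Real.exp (ϑ * H z) * Real.exp (-c * s) := by
    intro s z
    rw [hPg_apply]
    refine (hdecay z s.toNNReal).trans ?_
    refine mul_le_mul_of_nonneg_left (Real.exp_le_exp.2 ?_) (by positivity)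
    have : s ≤ (s.toNNReal : ℝ) := Real.le_coe_toNNReal s
    nlinarith
  -- the time majorant `MC e^{ϑH(z)} e^{-cs}` and its integral
  have hmaj : ∀ z : PhaseSpace N,
      IntegrableOn (fun s => M * C * Real.exp (ϑ * H z) * Real.exp (-c * s)) (Ioi (0 : ℝ)) :=
    fun z => (exp_neg_integrableOn_Ioi 0 hc).const_mul _
  have hexpI : ∫ s in Ioi (0 : ℝ), Real.exp (-c * s) = 1 / c := by
    rw [integral_exp_mul_Ioi (neg_lt_zero.2 hc) 0, mul_zero, Real.exp_zero, neg_div_neg_eq]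
  have hbound : ∀ z s, ‖Pg s z‖ ≤ M * C * Real.exp (ϑ * H z) * Real.exp (-c * s) := fun z s => by
    rw [Real.norm_eq_abs]; exact hPgb s z
  -- (A) absolute convergence of the McLennan integral
  have hA : ∀ z : PhaseSpace N, IntegrableOn (fun s => Pg s z) (Ioi (0 : ℝ)) := fun z =>
    Integrable.mono' (hmaj z) (hSMz z).aestronglyMeasurable (Eventually.of_forall (hbound z))
  -- sup bounds for `w` and `k τ`
  have hKw : ∀ z, |w z| ≤ M * C / c * Real.exp (ϑ * H z) := by
    intro z
    rw [hw_apply, ← Real.norm_eq_abs]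
    calc ‖∫ s in Ioi (0 : ℝ), Pg s z‖
        ≤ ∫ s in Ioi (0 : ℝ), M * C * Real.exp (ϑ * H z) * Real.exp (-c * s) :=
          norm_integral_le_of_norm_le (hmaj z) (Eventually.of_forall (hbound z))
      _ = M * C / c * Real.exp (ϑ * H z) := by rw [integral_const_mul, hexpI]; ring
  have hKk : ∀ τ : ℝ, 0 ≤ τ → ∀ z, |k τ z| ≤ M * C / c * Real.exp (ϑ * H z) := by
    intro τ hτ z
    rw [hk_apply, intervalIntegral.integral_of_le hτ, ← Real.norm_eq_abs]
    calc ‖∫ s in Ioc (0 : ℝ) τ, Pg s z‖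
        ≤ ∫ s in Ioc (0 : ℝ) τ, M * C * Real.exp (ϑ * H z) * Real.exp (-c * s) :=
          norm_integral_le_of_norm_le ((hmaj z).mono_set Ioc_subset_Ioi_self)
            (Eventually.of_forall (hbound z))
      _ ≤ ∫ s in Ioi (0 : ℝ), M * C * Real.exp (ϑ * H z) * Real.exp (-c * s) :=
          setIntegral_mono_set (hmaj z)
            (Eventually.of_forall fun s => by simp only [Pi.zero_apply]; positivity)
            Ioc_subset_Ioi_self.eventuallyLE
      _ = M * C / c * Real.exp (ϑ * H z) := by rw [integral_const_mul, hexpI]; ring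
  -- measurability and square integrability of `w` and `k τ`
  have hwSM : StronglyMeasurable w := by
    rw [hw]
    exact hSM.integral_prod_left
  have hkSM : ∀ τ : ℝ, 0 ≤ τ → StronglyMeasurable (k τ) := by
    intro τ hτ
    have hkτ : k τ = fun z => ∫ s in Ioc (0 : ℝ) τ, Pg s z := by
      funext z
      rw [hk_apply, intervalIntegral.integral_of_le hτ]
    rw [hkτ]
    exact hSM.integral_prod_left
  have hwL2 : MemLp w 2 μT := hL2 _ hwSM hKw
  have hkL2 : ∀ τ : ℝ, 0 ≤ τ → MemLp (k τ) 2 μT := fun τ hτ => hL2 _ (hkSM τ hτ) (hKk τ hτ)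
  -- Chapman–Kolmogorov: `P_{u+τ} g = P_τ (P_u g)`
  have hCK : ∀ u τ : ℝ, 0 ≤ u → 0 ≤ τ → ∀ z : PhaseSpace N,
      Pg (u + τ) z = ∫ x, Pg u x ∂(κ τ.toNNReal z) := by
    intro u τ hu hτ z
    have hadd : κ (u + τ).toNNReal = κ u.toNNReal ∘ₖ κ τ.toNNReal := by
      rw [Real.toNNReal_add hu hτ, add_comm, hκ,
        pinnedChain_transitionKernel_add hω hl.le hβ.le hγ.le N T T]
    rw [hPg_apply, hadd]
    simp_rw [hPg_apply]
    exact Kernel.integral_comp (by rw [← hadd]; exact hgint _ z)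
  -- translation `s = u + τ`
  have htrans : ∀ (τ : ℝ) (z : PhaseSpace N),
      ∫ s in Ioi τ, Pg s z = ∫ u in Ioi (0 : ℝ), Pg (u + τ) z := by
    intro τ z
    have h := (measurePreserving_add_right (volume : Measure ℝ) τ).setIntegral_preimage_emb
      (measurableEmbedding_addRight τ) (fun s => Pg s z) (Ioi τ)
    rw [Set.preimage_add_const_Ioi, sub_self] at h
    exact h.symm
  -- Fubini on `(0,∞) × P_τ(z, ·)`
  have hFub : ∀ (τ : ℝ) (z : PhaseSpace N),
      ∫ u in Ioi (0 : ℝ), ∫ x, Pg u x ∂(κ τ.toNNReal z) = ∫ x, w x ∂(κ τ.toNNReal z) := by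
    intro τ z
    have hprod : Integrable (Function.uncurry Pg)
        ((volume.restrict (Ioi (0 : ℝ))).prod (κ τ.toNNReal z)) := by
      refine Integrable.mono'
        ((Integrable.mul_prod (exp_neg_integrableOn_Ioi 0 hc) (hVint τ.toNNReal z)).const_mul
          (M * C)) hSM.aestronglyMeasurable (Eventually.of_forall fun p => ?_)
      calc ‖Function.uncurry Pg p‖ = ‖Pg p.1 p.2‖ := rfl
        _ ≤ M * C * Real.exp (ϑ * H p.2) * Real.exp (-c * p.1) := hbound p.2 p.1
        _ = M * C * (Real.exp (-c * p.1) * Real.exp (ϑ * H p.2)) := by ring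
    rw [hw]
    exact integral_integral_swap hprod
  -- the window identity
  have hident : ∀ τ : ℝ, 0 ≤ τ → ∀ z : PhaseSpace N, w z = k τ z + Pw τ z := by
    intro τ hτ z
    rw [hw_apply z, hk_apply τ z, hPw_apply τ z,
      ← intervalIntegral.integral_interval_add_Ioi (hA z) ((hA z).mono_set (Ioi_subset_Ioi hτ)),
      htrans τ z, ← hFub τ z]
    congr 1
    exact setIntegral_congr_fun measurableSet_Ioi fun u hu => hCK u τ (le_of_lt hu) hτ z
  refine ⟨hA, hwL2, fun τ hτ => ⟨hkL2 τ hτ, ?_, hident τ hτ⟩⟩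
  -- `P_τ w = w - k τ ∈ L²`
  have hPwτ : Pw τ = fun z => w z - k τ z := funext fun z => by rw [hident τ hτ z]; ring
  rw [hPwτ]
  exact hwL2.sub (hkL2 τ hτ)

end Helpers

/-- **Integrability package of the McLennan corrector (crux `ExtensiveSnapshotIrreversibility`,
line `clausius-budget-sound-window`).** For the pinned chain `P = pinnedChain ω₂ lam β γ`
(`ω₂, lam, β, γ > 0`, `N ≥ 2`, both baths at `T > 0`; kernels `P_t = P.transitionKernel N T T t`,
Gibbs state `μ_T`), ASSUME (INV) `μ_T P_t = μ_T` and (MIX) CEHR (2.5): for `0 < ϑ < 1/T` there are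
`C, c > 0` with `|P_t f(z) - μ_T(f)| ≤ C e^{ϑH(z)} e^{-ct}` for continuous `|f| ≤ e^{ϑH}`. With
`g = (γ/2T²)(p_0² - p_{N-1}²)`, `Pg s z = P_{s⁺} g(z)`, `k τ z = ∫₀^τ Pg s z ds`,
`w z = ∫_{(0,∞)} Pg s z ds`, `Pw τ z = P_{τ⁺} w(z)`: the `ds`-integral converges absolutely for
every `z`, `w ∈ L²(μ_T)`, and for every `τ ≥ 0`, `k τ, Pw τ ∈ L²(μ_T)` and `w = k τ + Pw τ`
POINTWISE. Proof: `corrector_window_of_decay`, once `μ_T(g) = 0` (exchange symmetry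
`p_0 ↔ p_{N-1}`, `integral_sq_sub_sq_gibbsMeasure`) and `|g| ≤ M e^{ϑH}` with `ϑ = 1/(4T)`,
`M = 16|a|T + 1`, `a = γ/2T²` (`abs_mul_sq_sub_sq_le_exp`) turn (MIX), applied to `g/M`, into the
decay `|P_t g(z)| ≤ MC e^{ϑH(z)} e^{-ct}`; (INV) is not needed.
[cite: CuneoEckmannHairerReyBellet2018, Thm 2.13 (3) eq. (2.5) and §3 eq. (3.4)] -/
theorem stub_correctorIntegrability :
    ∀ ω₂ lam β γ : ℝ, 0 < ω₂ → 0 < lam → 0 < β → 0 < γ → ∀ T : ℝ, 0 < T → ∀ (N : ℕ) (hN : 2 ≤ N),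
      let P := pinnedChain ω₂ lam β γ
      let μT := P.gibbsMeasure N T
      (∀ t : ℝ≥0, μT.bind (P.transitionKernel N T T t) = μT) →
      (∀ ϑ : ℝ, 0 < ϑ → ϑ < 1 / T → ∃ C c : ℝ, 0 < C ∧ 0 < c ∧
        ∀ (z : PhaseSpace N) (t : ℝ≥0) (f : PhaseSpace N → ℝ), Continuous f →
          (∀ y, |f y| ≤ Real.exp (ϑ * P.hamiltonian N y)) →
          |(∫ y, f y ∂(P.transitionKernel N T T t z)) - ∫ y, f y ∂μT| ≤
            C * Real.exp (ϑ * P.hamiltonian N z) * Real.exp (-c * t)) →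
      let g : PhaseSpace N → ℝ := fun y =>
        γ / (2 * T ^ 2) * (y.2 ⟨0, by omega⟩ ^ 2 - y.2 ⟨N - 1, by omega⟩ ^ 2)
      let Pg : ℝ → PhaseSpace N → ℝ := fun s z => ∫ y, g y ∂(P.transitionKernel N T T s.toNNReal z)
      let k : ℝ → PhaseSpace N → ℝ := fun τ z => ∫ s in (0 : ℝ)..τ, Pg s z
      let w : PhaseSpace N → ℝ := fun z => ∫ s in Set.Ioi (0 : ℝ), Pg s z
      let Pw : ℝ → PhaseSpace N → ℝ := fun τ z => ∫ x, w x ∂(P.transitionKernel N T T τ.toNNReal z)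
      (∀ z : PhaseSpace N, IntegrableOn (fun s => Pg s z) (Set.Ioi (0 : ℝ))) ∧
      MemLp w 2 μT ∧
      ∀ τ : ℝ, 0 ≤ τ → MemLp (k τ) 2 μT ∧ MemLp (Pw τ) 2 μT ∧ ∀ z : PhaseSpace N, w z = k τ z + Pw τ z := by
  intro ω₂ lam β γ hω hl hβ hγ T hT N hN P μT _hINV hMIX g Pg k w Pw
  have hN0 : 0 < N := by omega
  have hg_def : g = fun y : PhaseSpace N =>
      γ / (2 * T ^ 2) * (y.2 ⟨0, by omega⟩ ^ 2 - y.2 ⟨N - 1, by omega⟩ ^ 2) := rfl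
  -- the weight exponent `ϑ = 1/(4T)` and the growth constant `M`
  set ϑ : ℝ := 1 / (4 * T) with hϑ_def
  have hϑ : 0 < ϑ := by positivity
  have h2ϑ : 2 * ϑ < 1 / T := by
    have h1 : 2 * ϑ = 1 / T * (1 / 2) := by rw [hϑ_def]; field_simp; ring
    rw [h1]
    exact mul_lt_of_lt_one_right (by positivity) (by norm_num)
  have hϑT : ϑ < 1 / T := by linarith
  set M : ℝ := 4 * |γ / (2 * T ^ 2)| / ϑ + 1 with hM_def
  have hM : 0 < M := by positivity
  have hgc : Continuous g := by rw [hg_def]; fun_prop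
  have hgM : ∀ y, |g y| ≤ M * Real.exp (ϑ * P.hamiltonian N y) := by
    intro y
    rw [hg_def]
    calc |γ / (2 * T ^ 2) * (y.2 ⟨0, by omega⟩ ^ 2 - y.2 ⟨N - 1, by omega⟩ ^ 2)|
        ≤ 4 * |γ / (2 * T ^ 2)| / ϑ * Real.exp (ϑ * P.hamiltonian N y) :=
          abs_mul_sq_sub_sq_le_exp hω.le hl.le hβ.le γ _ hϑ _ _ y
      _ ≤ M * Real.exp (ϑ * P.hamiltonian N y) := by
          rw [hM_def]
          nlinarith [Real.exp_pos (ϑ * P.hamiltonian N y)]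
  -- `μ_T(g) = 0` by the exchange symmetry `p_0 ↔ p_{N-1}`
  have hmean : ∫ y, g y ∂μT = 0 := by
    rw [hg_def]
    exact integral_sq_sub_sq_gibbsMeasure ω₂ lam β γ _ T _ _
  -- (MIX) for the admissible observable `g / M`
  obtain ⟨C, c, hC, hc, hmix⟩ := hMIX ϑ hϑ hϑT
  have hf : Continuous fun y => g y / M := hgc.div_const M
  have hfb : ∀ y, |g y / M| ≤ Real.exp (ϑ * P.hamiltonian N y) := by
    intro y
    rw [abs_div, abs_of_pos hM, div_le_iff₀ hM, mul_comm]
    exact hgM y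
  have hdecay : ∀ (z : PhaseSpace N) (t : ℝ≥0), |∫ y, g y ∂(P.transitionKernel N T T t z)| ≤
      M * C * Real.exp (ϑ * P.hamiltonian N z) * Real.exp (-c * t) := by
    intro z t
    have h : |(∫ y, g y / M ∂(P.transitionKernel N T T t z)) - ∫ y, g y / M ∂μT| ≤
        C * Real.exp (ϑ * P.hamiltonian N z) * Real.exp (-c * t) := hmix z t (fun y => g y / M) hf hfb
    rw [integral_div, integral_div, hmean, zero_div, sub_zero, abs_div, abs_of_pos hM,
      div_le_iff₀ hM] at h
    calc |∫ y, g y ∂(P.transitionKernel N T T t z)|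
        ≤ C * Real.exp (ϑ * P.hamiltonian N z) * Real.exp (-c * t) * M := h
      _ = M * C * Real.exp (ϑ * P.hamiltonian N z) * Real.exp (-c * t) := by ring
  exact corrector_window_of_decay hω hl hβ hγ hT hN0 hϑ h2ϑ hM.le hC.le hc hgc hgM hdecay
    Pg rfl k rfl w rfl Pw rfl

end Summit.AtomisticToContinuum.FouriersLaw.Theorems.ExtensiveSnapshotIrreversibility.ClausiusBudget

end
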